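import Mathlib.FieldTheory.Finite.Basic
import Literature.RepresentationTheory.GL2SymmetricPowerIrreducible
import Literature.RepresentationTheory.FiniteGroups.GL2ModularPrincipalSeriesSocleStep
import Literature.RepresentationTheory.FiniteGroups.GL2ModularPrincipalSeriesSymPow
import HarnessLib

/-!
# The socle of the mod-`p` principal series of `GL₂(𝔽_p)`: for `χ₁ ≠ χ₂ = χ₁·(·)^r`, `0 ≤ r < p`,
# `soc Ind_B^{GL₂(𝔽_p)}(χ₁ ⊗ χ₂) = Sym^r k² ⊗ (χ₁ ∘ det)`, a simple module

Topic `Literature/RepresentationTheory/FiniteGroups`, namespace `Literature.RepresentationTheory.FiniteGroups.GL2`.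
THEOREMS ONLY (no definition, no named fact, no instance, no notation, no `sorry`); assembles
(Coefficient note: the defining file `GL2ModularPrincipalSeries` now allows any commutative coefficient ring — the integral structure `Fun_R(Ind(χ₁ ⊗ χ₂))` of `GL2ModularPrincipalSeriesBruhatBasis` / `…Reduction` —; this file keeps `k` a field.)
`GL2ModularPrincipalSeriesSocleStep` (every proper nonzero subrepresentation contains `f_w`),
`GL2ModularPrincipalSeriesSymPow` (the embedding `Φ` of `Sym^r ⊗ χ₁∘det`) and Brauer–Nesbitt
(`Literature/RepresentationTheory/GL2SymmetricPowerIrreducible`: `Sym^r k²` is an irreducible `GL₂(𝔽_p)`-module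
for `r < p`).

Source: M. Emerton, T. Gee, D. Savitt, *Lattices in the cohomology of Shimura curves* [EmertonGeeSavitt2015]
§3.2 (held `paper:arxiv-1305.1594`, p0011–p0012): «We will assume from now on that `η ≠ η'`, and we write …
`0 < c_χ < p^f − 1` such that `η(x̄) η'⁻¹(x̄) = [x̄]^{c_χ}` … The Jordan–Hölder factors of `σ̄(χ)` are
parameterised by `𝒫_{σ(χ)}` in the following fashion (see Lemma 2.2 of [Breuil–Paškūnas] or Proposition 1.1 of
[Diamond]) … `σ̄(χ)_J := σ̄_{t,s} ⊗ η'∘det`»; for `f = 1`: `σ̄(χ)_∅ = Sym^c ⊗ η'∘det`,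
`σ̄(χ)_{{0}} = det^c Sym^{p−1−c} ⊗ η'∘det`.  Dictionary: `η' = χ₁`, `η = χ₂`, `c = r`,
`σ̄(χ) = principalSeriesRep (ZMod p) χ₁ χ₂` over any field `k` of characteristic `p` (not only `𝔽̄_p`).

## What is proved (`p` prime, `k` a field with `CharP k p`, `f = ZMod.castHom _ k : 𝔽_p → k`)

* **`symPowSubrep_le_of_ne_bot`** — if `χ₁ ≠ χ₂`, `χ₂(a) = χ₁(a) f(a)^r` and `r < p`, the subrepresentation
  `Sym^r k² ⊗ (χ₁∘det) = symPowSubrep f χ₁ χ₂ r hχ` of `Ind_B^{GL₂(𝔽_p)}(χ₁ ⊗ χ₂)` is contained in EVERY nonzero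
  subrepresentation: it is the socle, and the socle is simple.  (Proof: both the given `S` and `Sym^r ⊗ χ₁∘det`
  are proper and nonzero, so both contain `f_w` (socle step); the preimage of `S` under `Φ` is then a nonzero
  subrepresentation of the irreducible `Sym^r ⊗ χ₁∘det`, hence everything.)
* `isIrreducible_symPowSubrep` — this socle is an irreducible representation (Brauer–Nesbitt transported
  along the injective intertwiner `Φ`);
* the standard parametrisation `χ₂ := χ₁ · ε^r`, `ε = Units.map f` the tautological character:
  `coe_mul_pow_unitsMap_castHom_apply` (the hypothesis `hχ` holds), `ne_mul_pow_unitsMap_castHom`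
  (`χ₁ ≠ χ₁ε^r` for `0 < r < p − 1`, since `𝔽_pˣ` is cyclic of order `p − 1`), and the packaged statement
  **`symPowSubrep_le_of_ne_bot_of_pos_of_lt`** for `0 < r < p − 1`.

Sequels: the cosocle / second Jordan–Hölder factor `det^r Sym^{p−1−r} ⊗ χ₁∘det` and uniseriality (length two)
via the intertwining operator `T : 𝓑(χ₁,χ₂) → 𝓑(χ₂,χ₁)` and the dimension count `dim 𝓑 = p + 1` are
`GL2ModularPrincipalSeriesIntertwiner` / `GL2ModularPrincipalSeriesLengthTwo`.  Not here: the split case `χ₁ = χ₂`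
(`𝓑 = χ₁∘det ⊕ St ⊗ χ₁∘det`), `𝔽_q` with `q = p^f`, `f > 1`.
-/

namespace Literature.RepresentationTheory.FiniteGroups

namespace GL2

open Matrix

section Socle

open MvPolynomial

variable (p : ℕ) [Fact p.Prime] {k : Type*} [Field k] [CharP k p] {χ₁ χ₂ : (ZMod p)ˣ →* kˣ} {r : ℕ}

/-- **Socle of the mod-`p` principal series of `GL₂(𝔽_p)` (Breuil–Paškūnas / Diamond).**  Let `k` be a field
of characteristic `p`, `χ₁ ≠ χ₂ : 𝔽_pˣ → kˣ` with `χ₂ = χ₁ · (·)^r`, `0 ≤ r < p`.  Then the image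
`Sym^r k² ⊗ (χ₁ ∘ det)` of `Φ` is contained in EVERY nonzero subrepresentation of `Ind_B^{GL₂(𝔽_p)}(χ₁ ⊗ χ₂)`:
it is the socle, and the socle is simple (the constituent `σ̄(χ)_∅ = Sym^r ⊗ η'∘det` of [EGS §3.2] is the
socle of the mod-`p` induction). [cite: EmertonGeeSavitt2015, §3.2] -/
theorem symPowSubrep_le_of_ne_bot (hχne : χ₁ ≠ χ₂)
    (hχ : ∀ a : (ZMod p)ˣ, (χ₂ a : k) = (χ₁ a : k) * ZMod.castHom (dvd_refl p) k a ^ r) (hr : r < p)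
    (S : Subrepresentation (principalSeriesRep (ZMod p) χ₁ χ₂)) (hS : S ≠ ⊥) :
    symPowSubrep (ZMod.castHom (dvd_refl p) k) χ₁ χ₂ r hχ ≤ S := by
  have hr' : r < Fintype.card (ZMod p) := by rwa [ZMod.card]
  by_cases hS' : S = ⊤
  · rw [hS']; exact le_top
  -- `f_w ∈ S` and `f_w ∈ Sym^r`-image
  have hwS : deltaBigCell χ₁ χ₂ ∈ S := deltaBigCell_mem_of_ne_bot_of_ne_top p χ₁ χ₂ hχne S hS hS'
  have hwΦ : deltaBigCell χ₁ χ₂ ∈ symPowSubrep (ZMod.castHom (dvd_refl p) k) χ₁ χ₂ r hχ :=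
    deltaBigCell_mem_of_ne_bot_of_ne_top p χ₁ χ₂ hχne _ (symPowSubrep_ne_bot hχ hr')
      (symPowSubrep_ne_top hχ hr')
  obtain ⟨φw, hφw⟩ := hwΦ
  -- the preimage of `S` in the (irreducible) twisted `Sym^r` is a nonzero subrepresentation, hence everything
  set Φ := symPowToPrincipalSeries (ZMod.castHom (dvd_refl p) k) χ₁ χ₂ r hχ with hΦ
  let T : Subrepresentation (symPowTwist (ZMod.castHom (dvd_refl p) k) χ₁ r) :=
    ⟨S.toSubmodule.comap Φ, fun h φ hφ => by
      simp only [Submodule.mem_comap] at hφ ⊢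
      rw [symPowTwist_apply, ← symPowToPrincipalSeries_symPowGL]
      exact S.apply_mem_toSubmodule h hφ⟩
  haveI : (symPowTwist (ZMod.castHom (dvd_refl p) k) χ₁ r).IsIrreducible :=
    isIrreducible_of_eq_units_smul_symPowGL _ r (natCast_ne_zero_of_lt_charP p hr) _
      (fun h => χ₁ (Matrix.GeneralLinearGroup.det h)) (fun _ _ => rfl)
  have hT : T = ⊥ ∨ T = ⊤ := IsSimpleOrder.eq_bot_or_eq_top T
  have hφwT : φw ∈ T := by
    change Φ φw ∈ S.toSubmodule
    rw [hφw]; exact hwS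
  have hφw0 : φw ≠ 0 := by
    intro h0; rw [h0, map_zero] at hφw; exact deltaBigCell_ne_zero χ₁ χ₂ hφw.symm
  rcases hT with hT | hT
  · exfalso
    have : φw ∈ (⊥ : Subrepresentation (symPowTwist (ZMod.castHom (dvd_refl p) k) χ₁ r)) := hT ▸ hφwT
    exact hφw0 this
  · rintro _ ⟨φ, rfl⟩
    have : φ ∈ T := by rw [hT]; trivial
    exact this

/-- The socle `Sym^r ⊗ (χ₁ ∘ det)` of `Ind_B^{GL₂(𝔽_p)}(χ₁ ⊗ χ₂)` is an irreducible representation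
(transport of Brauer–Nesbitt, `isIrreducible_of_eq_units_smul_symPowGL`, along `Φ`). [cite: EmertonGeeSavitt2015, §3.2] -/
theorem isIrreducible_symPowSubrep
    (hχ : ∀ a : (ZMod p)ˣ, (χ₂ a : k) = (χ₁ a : k) * ZMod.castHom (dvd_refl p) k a ^ r) (hr : r < p) :
    Representation.IsIrreducible
      (V := (symPowSubrep (ZMod.castHom (dvd_refl p) k) χ₁ χ₂ r hχ).toSubmodule)
      (symPowSubrep (ZMod.castHom (dvd_refl p) k) χ₁ χ₂ r hχ).toRepresentation := by
  have hr' : r < Fintype.card (ZMod p) := by rwa [ZMod.card]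
  haveI : (symPowTwist (ZMod.castHom (dvd_refl p) k) χ₁ r).IsIrreducible :=
    isIrreducible_of_eq_units_smul_symPowGL _ r (natCast_ne_zero_of_lt_charP p hr) _
      (fun h => χ₁ (Matrix.GeneralLinearGroup.det h)) (fun _ _ => rfl)
  let e : homogeneousSubmodule (Fin 2) k r ≃ₗ[k]
      (symPowSubrep (ZMod.castHom (dvd_refl p) k) χ₁ χ₂ r hχ).toSubmodule :=
    LinearEquiv.ofInjective _ (symPowToPrincipalSeries_injective hχ hr')
  refine (@Representation.isIrreducible_iff_of_equivariant k (GL (Fin 2) (ZMod p)) (GL (Fin 2) (ZMod p))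
    (homogeneousSubmodule (Fin 2) k r) ((symPowSubrep (ZMod.castHom (dvd_refl p) k) χ₁ χ₂ r hχ).toSubmodule)
    _ _ _ _ _ _ _
    (symPowTwist (ZMod.castHom (dvd_refl p) k) χ₁ r)
    (symPowSubrep (ZMod.castHom (dvd_refl p) k) χ₁ χ₂ r hχ).toRepresentation (MonoidHom.id _)
    Function.surjective_id e fun h φ => ?_).mp inferInstance
  refine Subtype.ext ?_
  change symPowToPrincipalSeries _ χ₁ χ₂ r hχ (symPowTwist _ χ₁ r h φ) =
    principalSeriesRep (ZMod p) χ₁ χ₂ h (symPowToPrincipalSeries _ χ₁ χ₂ r hχ φ)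
  rw [symPowTwist_apply, symPowToPrincipalSeries_symPowGL]

/-- The standard parametrisation: `χ₂ := χ₁ · ε^r` with `ε : 𝔽_pˣ → kˣ` the tautological character
satisfies the hypothesis `χ₂(a) = χ₁(a) · a^r` of the socle theorem (EGS: `η η'⁻¹ = [·]^c`). [cite: EmertonGeeSavitt2015, §3.2] -/
theorem coe_mul_pow_unitsMap_castHom_apply (χ₁ : (ZMod p)ˣ →* kˣ) (r : ℕ) (a : (ZMod p)ˣ) :
    ((χ₁ * Units.map ((ZMod.castHom (dvd_refl p) k).toMonoidHom) ^ r) a : k) =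
      (χ₁ a : k) * ZMod.castHom (dvd_refl p) k a ^ r := by
  simp [Units.val_pow_eq_pow_val]

/-- For `0 < r < p − 1` the characters `χ₁` and `χ₁ · ε^r` of `𝔽_pˣ` are distinct (`ε` has order
`p − 1`, `𝔽_pˣ` being cyclic; EGS's standing assumption `η ≠ η'`, `0 < c < p − 1`). [cite: EmertonGeeSavitt2015, §3.2] -/
theorem ne_mul_pow_unitsMap_castHom (χ₁ : (ZMod p)ˣ →* kˣ) {r : ℕ} (h0 : 0 < r) (hr : r < p - 1) :
    χ₁ ≠ χ₁ * Units.map ((ZMod.castHom (dvd_refl p) k).toMonoidHom) ^ r := by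
  intro h
  have hε : Units.map ((ZMod.castHom (dvd_refl p) k).toMonoidHom) ^ r = (1 : (ZMod p)ˣ →* kˣ) :=
    mul_left_cancel (h.symm.trans (mul_one χ₁).symm)
  obtain ⟨g, hg⟩ := IsCyclic.exists_generator (α := (ZMod p)ˣ)
  have horder : orderOf g = p - 1 := by
    rw [orderOf_eq_card_of_forall_mem_zpowers hg, Nat.card_eq_fintype_card, ZMod.card_units]
  have hg1 : ((g : ZMod p) ^ r : ZMod p) = 1 := by
    have := DFunLike.congr_fun hε g
    simp only [MonoidHom.pow_apply, MonoidHom.one_apply] at this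
    have h' := congrArg (fun u : kˣ => (u : k)) this
    simp only [Units.val_pow_eq_pow_val, Units.coe_map, RingHom.toMonoidHom_eq_coe, MonoidHom.coe_coe,
      Units.val_one, ← map_pow] at h'
    exact (ZMod.castHom (dvd_refl p) k).injective (by rw [h', map_one])
  have hgr : g ^ r = 1 := Units.ext (by rw [Units.val_pow_eq_pow_val, Units.val_one]; exact hg1)
  have hdvd : p - 1 ∣ r := horder ▸ orderOf_dvd_of_pow_eq_one hgr
  exact absurd (Nat.le_of_dvd h0 hdvd) (not_le.mpr hr)

/-- **Socle of `Ind_B^{GL₂(𝔽_p)}(χ₁ ⊗ χ₁ε^r)`, `0 < r < p − 1`** (the generic = non-split case): the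
subrepresentation `Sym^r k² ⊗ (χ₁ ∘ det)` lies in every nonzero subrepresentation, i.e. it is the (simple)
socle. [cite: EmertonGeeSavitt2015, §3.2] -/
theorem symPowSubrep_le_of_ne_bot_of_pos_of_lt (χ₁ : (ZMod p)ˣ →* kˣ) {r : ℕ} (h0 : 0 < r) (hr : r < p - 1)
    (S : Subrepresentation (principalSeriesRep (ZMod p) χ₁
      (χ₁ * Units.map ((ZMod.castHom (dvd_refl p) k).toMonoidHom) ^ r)))
    (hS : S ≠ ⊥) :
    symPowSubrep (ZMod.castHom (dvd_refl p) k) χ₁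
        (χ₁ * Units.map ((ZMod.castHom (dvd_refl p) k).toMonoidHom) ^ r) r
        (coe_mul_pow_unitsMap_castHom_apply p χ₁ r) ≤ S :=
  symPowSubrep_le_of_ne_bot p (ne_mul_pow_unitsMap_castHom p χ₁ h0 hr)
    (coe_mul_pow_unitsMap_castHom_apply p χ₁ r) (by omega) S hS

end Socle

end GL2

end Literature.RepresentationTheory.FiniteGroups
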